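import Summits.QuantumFields.YangMills.Theorems.BalabanUVNodesN11Sect3SupplyChainTermRows

/-!
# DAG node N11 — THE TERM-ROWS ROAD AT THE H-EXTENSIONS OF THE WITNESS OF RECORD: the 𝐑-side token `RStepW` INHABITED there (`hrec` only), and THEOREM 1 OF [III] ∕
# `B16.Thm1Printed` there from `hrec` + `SupplierObligations` + the witness-free `ResidualRows` (or a Gaussian certificate) + the supplier's OWN `SupplierTermRows` — nothing else

HEADER — WORK-UNIT METADATA.  Cell `pub-ymgap`, YM-PLAN Track A (HUMAN RULING D-0062 ∕ D-0149 width seats), seat `pub-ymgap-dag-n11-w3` (g2; WIDTH SEAT 3∕4 on NODE n11 [B14],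
director-ym №197), route `BalabanUVNodes` (v1.7 `CoPH` key), item K1⁷ `StabilityBAtRecordR13SepCoPH` = stmt-QuantumFields-20542 (helper lane `--kind proof --supports 20542 --as helper`,
count-neutral).  The record-door corollaries of this seat's p599012 `…Sect3SupplyChainTermRows` (W3-Z1) and p597488 `…RStepWitnessDefs` (the token), in the shape of dag-n11-e g16's
p596032 `…Sect3SupplyChainNode` §3 (`sLaw₁₃CoPH_all_theta13LiveOfRecordH_of_obligations[_of_rows]`, `sLaw₁₃CoPH_all_gaussCertH_theta13LiveOfRecord_of_obligations_of_operandRows`,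
`thm1Printed_datumOfRecord₁₃CoPH_theta13LiveOfRecordH_of_obligations`: selector `rfl`, `admissible_theta13LiveOfRecord`, the family's signs, `M = 1` by `le_of_eq rfl`).
[III] = [Balaban1988Convergent], [IV] = [Balaban1989LargeFieldI], [B16] = [Balaban1989LargeFieldII].

WHY THIS FILE.  After p599012, def-T's operand rows along the chain follow from the supplier's own term rows (`operandRowsAlongChain_of_supplierTermRows`).  Read at any H-extension
`⟨⟨θ₁₃, Zr⟩, Zh, Phih⟩` of the witness of record `θ₁₃ = theta13LiveOfRecord F N` — where the live-selector side conditions are the tree's — N11's state becomes: THEOREM 1 OF [III], all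
levels and histories, from `hrec` (the datum's key) + `SupplierObligations` ([III] §3 along the supplier's own chain) + `SupplierTermRows` (measurability ∕ bounds of the supplier's own
terms) + EITHER the witness-free `ResidualRows` with `ZhUnity` (dag-n11-d ∕ K0b data rows) OR a Gaussian certificate on `Zh` (then NOTHING of the no-expansion lane) — every
supplier-side hypothesis a property of the supplier's OWN constructed terms.  And the 𝐑-side token `RStepW` of p597488 HOLDS at every such extension from `hrec` alone (§1), so the
generic-`θ` `RStepW.*` theorems instantiate there by name.

WHAT THIS FILE PROVES (0 `def`, 0 `sorry`, standard axioms; one-line compositions).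
§1 A6: ★ `RStepW.theta13LiveOfRecordH` — `RStepW ⟨⟨θ₁₃, Zr⟩, Zh, Phih⟩ p` from `hrec` (p597488 §2 with selector `rfl`, `admissible_theta13LiveOfRecord`, the family's `κ, E₀, B₀ ≥ 0`).
§2 ★★★ `sLaw₁₃CoPH_all_theta13LiveOfRecordH_of_obligations_of_residualRows_of_supplierTermRows` (`hrec`, `ZhUnity`, `hσ`, `ResidualRows`, `SupplierTermRows` — nothing else) ·
   ★★★ `sLaw₁₃CoPH_all_gaussCertH_theta13LiveOfRecord_of_obligations_of_supplierTermRows` (THE HONEST STATE OF N11 AT A GAUSSIAN DOOR OF THE WITNESS OF RECORD: `hrec` + `SupplierObligations`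
   + `SupplierTermRows`, NOTHING ELSE) · `tLaw₁₃CoPH_all_gaussCertH_theta13LiveOfRecord_of_obligations_of_supplierTermRows` (the 𝐓-images too).
§3 ★★ `thm1Printed_datumOfRecord₁₃CoPH_theta13LiveOfRecordH_of_obligations_of_residualRows_of_supplierTermRows` — `B16.Thm1Printed` at the CoPH datum of the extension from a supplier per
   windowed run with its obligations + its term rows, `ZhUnity` and `ResidualRows` (p596032's per-run face with the no-expansion obligation DISCHARGED from the rows).

HONEST FRAMING.  Helper lane, count-neutral KERNEL BOOKKEEPING; `SupplierObligations` ([III] §3 ∕ Thm 2's content), `SupplierTermRows`, `ResidualRows` ∕ the Gaussian certificate and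
`hrec` are DISPLAYED, not proved; nothing of Bałaban is asserted; N11 is NOT discharged; K1⁷ is NOT closed; counts unmoved (typed 28∕28 · discharged 5∕27).  One finite `𝕋⁴_{L^K}`
programme at fixed `ε = L^{−K}`; R4 closes only the conditional finite-𝕋⁴ rung `BalabanLadder.UV` — NOT ℝ⁴, NOT OS, NOT a mass gap, NOT Clay.  No `sorry`, no `axiom`, no `def`.
Sources: [III] Theorem p.245, p.244 L36–38, Thm 1 p.262, Thm 2 p.263, §3 p.279, (3.24)–(3.25) p.270, (3.16)–(3.23) pp.268–270, (1.11) p.248, (2.23) p.258; [IV] (0.3)–(0.4) p.176, p.177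
(i)–(ii); [B16] Thm 1 p.355.
-/

noncomputable section

open MeasureTheory
open scoped BigOperators ENNReal NNReal Matrix.Norms.L2Operator

namespace Summit.QuantumFields.YangMills.Theorems.BalabanUVNodesN11Sect3SupplyChainTermRowsAtRecord

open Literature.MathematicalPhysics.QuantumFieldTheory.Balaban1983to89 T4Continuum Node00 Node00.Tk DagBinding
open Literature.MathematicalPhysics.QuantumFieldTheory.Balaban1983to89.B16RLeafRecord13AtLive (kappa_nonneg_theta13LiveOfFamily B0_nonneg_theta13LiveOfFamily
  E0_nonneg_theta13LiveOfFamily)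
open B10Eq42TorusConstraint (bondsIn)
open BalabanUVNodesN11HistoryPinnedResidualDefs (ZhPinOfRecord₁₃)
open BalabanUVNodesN11Sect3SupplyChainDefs
open BalabanUVNodesN11Sect3SupplyChainObligationsDefs
open BalabanUVNodesN11Sect3SupplyChainNode (sLaw₁₃CoPH_all_theta13LiveOfRecordH_of_obligations_of_rows sLaw₁₃CoPH_all_gaussCertH_theta13LiveOfRecord_of_obligations_of_operandRows
  tLaw₁₃CoPH_all_theta13LiveOfRecordH_of_obligations thm1Printed_datumOfRecord₁₃CoPH_theta13LiveOfRecordH_of_obligations)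
open BalabanUVNodesN11RStepWitnessDefs (RStepW RStepW.of_liveSel_of_rstep)
open BalabanUVNodesN11Sect3SupplyChainTermRows (SupplierTermRows operandRowsAlongChain_of_supplierTermRows)

variable (F : T4Family) (N : ℕ) [NeZero N]
variable {Zr : (q : B12.RunParams) → TkResidualW F N (FluctV N) q.K}
  {Zh : (q : B12.RunParams) → ℕ → (ℕ → Set (Site (F.P q.K) 0)) → (ℕ → Set (Site (F.P q.K) 0)) → TkResidualW F N (FluctV N) q.K}
  {Phih : (q : B12.RunParams) → ℕ → (ℕ → Set (Site (F.P q.K) 0)) → (ℕ → Set (Site (F.P q.K) 0)) → (ℕ → Plaq (F.P q.K) 0 → ℝ)} (p : B12.RunParams)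

/-! ## §1. A6 — the 𝐑-side token at the H-extensions of the witness of record -/

/-- **★ A6 — `RStepW ⟨⟨θ₁₃, Zr⟩, Zh, Phih⟩ p` HOLDS AT EVERY H-EXTENSION OF THE WITNESS OF RECORD FROM `hrec` ALONE**: there the selector clause is `rfl` (K0a's live re-pin),
admissibility is `admissible_theta13LiveOfRecord`, and `0 ≤ κ, E₀, B₀` are the family's numerals — p597488's `RStepW.of_liveSel_of_rstep`.  So every generic-`θ` `RStepW.*` face
(p597488 §3–§6, p599012 §6) instantiates at the record by name. [cite: Balaban1988Convergent, p.244 L36–38, §2 p.262, (3.24)–(3.25) p.270, (1.11) p.248; Balaban1989LargeFieldI, (0.3)–(0.4) p.176, p.177 (i)–(ii)] -/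
theorem _root_.Summit.QuantumFields.YangMills.Theorems.BalabanUVNodesN11RStepWitnessDefs.RStepW.theta13LiveOfRecordH
    (hrec : (⟨⟨theta13LiveOfRecord F N, Zr⟩, Zh, Phih⟩ : Stage13HParams F N).Provisos₁₃CoPH F N) :
    RStepW (⟨⟨theta13LiveOfRecord F N, Zr⟩, Zh, Phih⟩ : Stage13HParams F N) p :=
  RStepW.of_liveSel_of_rstep _ p hrec rfl (admissible_theta13LiveOfRecord F N)
    (kappa_nonneg_theta13LiveOfFamily F N eps0OfRecord₁₃ (zeta316OfRecord F N (numerics7OfFamily eps0OfRecord₁₃) 1 1) (RzOfRecord F N) (ZtOfRecord F N))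
    (E0_nonneg_theta13LiveOfFamily F N eps0OfRecord₁₃ (zeta316OfRecord F N (numerics7OfFamily eps0OfRecord₁₃) 1 1) (RzOfRecord F N) (ZtOfRecord F N))
    (B0_nonneg_theta13LiveOfFamily F N eps0OfRecord₁₃ (zeta316OfRecord F N (numerics7OfFamily eps0OfRecord₁₃) 1 1) (RzOfRecord F N) (ZtOfRecord F N))

/-! ## §2. Theorem 1 of [III] at the H-extensions of the witness of record with the operand rows discharged from the supplier's term rows -/

/-- **★★★ THEOREM 1 OF [III] AT ANY H-EXTENSION OF THE WITNESS OF RECORD, ALL LEVELS, ALL HISTORIES, FROM `hrec`, `ZhUnity`, THE SUPPLIER's OBLIGATIONS ALONG ITS CHAIN, THE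
WITNESS-FREE RESIDUAL ROWS AND THE SUPPLIER's OWN TERM ROWS — NOTHING ELSE** (p596032's `…_of_obligations_of_rows` with def-T's `OperandRowsAlongChain` DISCHARGED by p599012's
`operandRowsAlongChain_of_supplierTermRows`). [cite: Balaban1988Convergent, Thm 1 p.262, Theorem p.245, p.244, (3.24)–(3.25) p.270, (3.16)–(3.22) pp.268–269, (2.23) p.258, (1.11) p.248; Balaban1989LargeFieldI, (0.3)–(0.4) p.176, p.177 (i)–(ii)] -/
theorem sLaw₁₃CoPH_all_theta13LiveOfRecordH_of_obligations_of_residualRows_of_supplierTermRows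
    (hrec : (⟨⟨theta13LiveOfRecord F N, Zr⟩, Zh, Phih⟩ : Stage13HParams F N).Provisos₁₃CoPH F N)
    (hU : (⟨⟨theta13LiveOfRecord F N, Zr⟩, Zh, Phih⟩ : Stage13HParams F N).ZhUnity F N)
    (σ : Sect3Supplier (⟨⟨theta13LiveOfRecord F N, Zr⟩, Zh, Phih⟩ : Stage13HParams F N) p)
    (hσ : SupplierObligations (⟨⟨theta13LiveOfRecord F N, Zr⟩, Zh, Phih⟩ : Stage13HParams F N) p σ)
    (hres : ResidualRows (⟨⟨theta13LiveOfRecord F N, Zr⟩, Zh, Phih⟩ : Stage13HParams F N) p)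
    (hσr : SupplierTermRows (⟨⟨theta13LiveOfRecord F N, Zr⟩, Zh, Phih⟩ : Stage13HParams F N) p σ) :
    ∀ k, k ≤ p.K → SLaw₁₃CoPH F N (⟨⟨theta13LiveOfRecord F N, Zr⟩, Zh, Phih⟩ : Stage13HParams F N) p k :=
  sLaw₁₃CoPH_all_theta13LiveOfRecordH_of_obligations_of_rows F N p hrec hU σ hσ hres (operandRowsAlongChain_of_supplierTermRows hσr)

/-- **★★★ THE HONEST STATE OF N11 AT A GAUSSIAN DOOR OF THE WITNESS OF RECORD, WITNESS-THREADED, EVERYTHING ON THE SUPPLIER's SIDE ABOUT ITS OWN TERMS**: at any H-extension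
`⟨⟨θ₁₃, Zr⟩, Zh, Phih⟩` of `θ₁₃ = theta13LiveOfRecord F N` whose `Zh` carries the certificate's `ζ0` and the A-fibre Gaussian `quad`, THEOREM 1 OF [III], ALL LEVELS, ALL HISTORIES,
holds FROM `hrec` (the datum's key), `SupplierObligations` ([III] §3 along the supplier's own chain) and `SupplierTermRows` (measurability ∕ bounds of the supplier's own terms) — AND NOTHING
ELSE: no `ZhUnity`, no residual row, no K0b row, no operand row, no selector ∕ admissibility ∕ sign hypothesis (p596032's `…_of_obligations_of_operandRows` over p599012).
[cite: Balaban1988Convergent, Thm 1 p.262, Theorem p.245, p.244, (3.23)–(3.25) p.270, (2.23) p.258, (1.11) p.248, (3.16)–(3.22) pp.268–269; Balaban1989LargeFieldI, (0.3)–(0.4) p.176, p.177 (i)–(ii)] -/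
theorem sLaw₁₃CoPH_all_gaussCertH_theta13LiveOfRecord_of_obligations_of_supplierTermRows
    (hζ : ∀ (p : B12.RunParams) (n : ℕ) (Ω Λ : ℕ → Set (Site (F.P p.K) 0)), (Zh p n Ω Λ).ζ0 = (ZhPinOfRecord₁₃ (theta13LiveOfRecord F N) p Ω Λ).ζ0)
    (hq : ∀ (p : B12.RunParams) (n : ℕ) (Ω Λ : ℕ → Set (Site (F.P p.K) 0)) (j : ℕ) (Λ' : Set (Site (F.P p.K) 0)) (ω : MultiCfg (F.P p.K) (SU N) (FluctV N)),
      (Zh p n Ω Λ).quad j Λ' ω = ∑ b ∈ (Set.toFinite (bondsIn j (Λ'ᶜ ∩ Ω (j + 1)))).toFinset, ‖(ω j).2 b‖ ^ 2)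
    (hrec : (⟨⟨theta13LiveOfRecord F N, Zr⟩, Zh, Phih⟩ : Stage13HParams F N).Provisos₁₃CoPH F N)
    (σ : Sect3Supplier (⟨⟨theta13LiveOfRecord F N, Zr⟩, Zh, Phih⟩ : Stage13HParams F N) p)
    (hσ : SupplierObligations (⟨⟨theta13LiveOfRecord F N, Zr⟩, Zh, Phih⟩ : Stage13HParams F N) p σ)
    (hσr : SupplierTermRows (⟨⟨theta13LiveOfRecord F N, Zr⟩, Zh, Phih⟩ : Stage13HParams F N) p σ) :
    ∀ k, k ≤ p.K → SLaw₁₃CoPH F N (⟨⟨theta13LiveOfRecord F N, Zr⟩, Zh, Phih⟩ : Stage13HParams F N) p k :=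
  sLaw₁₃CoPH_all_gaussCertH_theta13LiveOfRecord_of_obligations_of_operandRows F N p hζ hq hrec σ hσ (operandRowsAlongChain_of_supplierTermRows hσr)

/-- **… AND THE 𝐓-IMAGES `∀ k < K, TLaw₁₃CoPH … p k` AT SUCH A GAUSSIAN DOOR from `hrec`, `SupplierObligations`, `SupplierTermRows` — nothing else** (p596032's
`tLaw₁₃CoPH_all_theta13LiveOfRecordH_of_obligations` with the no-expansion obligation DISCHARGED by p595576 §5's Gaussian-class face over p599012).
[cite: Balaban1988Convergent, Theorem p.245, remark p.262, §3 p.279, (3.23)–(3.25) p.270; Balaban1989LargeFieldI, (0.3)–(0.4) p.176] -/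
theorem tLaw₁₃CoPH_all_gaussCertH_theta13LiveOfRecord_of_obligations_of_supplierTermRows
    (hζ : ∀ (p : B12.RunParams) (n : ℕ) (Ω Λ : ℕ → Set (Site (F.P p.K) 0)), (Zh p n Ω Λ).ζ0 = (ZhPinOfRecord₁₃ (theta13LiveOfRecord F N) p Ω Λ).ζ0)
    (hq : ∀ (p : B12.RunParams) (n : ℕ) (Ω Λ : ℕ → Set (Site (F.P p.K) 0)) (j : ℕ) (Λ' : Set (Site (F.P p.K) 0)) (ω : MultiCfg (F.P p.K) (SU N) (FluctV N)),
      (Zh p n Ω Λ).quad j Λ' ω = ∑ b ∈ (Set.toFinite (bondsIn j (Λ'ᶜ ∩ Ω (j + 1)))).toFinset, ‖(ω j).2 b‖ ^ 2)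
    (hrec : (⟨⟨theta13LiveOfRecord F N, Zr⟩, Zh, Phih⟩ : Stage13HParams F N).Provisos₁₃CoPH F N)
    (σ : Sect3Supplier (⟨⟨theta13LiveOfRecord F N, Zr⟩, Zh, Phih⟩ : Stage13HParams F N) p)
    (hσ : SupplierObligations (⟨⟨theta13LiveOfRecord F N, Zr⟩, Zh, Phih⟩ : Stage13HParams F N) p σ)
    (hσr : SupplierTermRows (⟨⟨theta13LiveOfRecord F N, Zr⟩, Zh, Phih⟩ : Stage13HParams F N) p σ) :
    ∀ k, k < p.K → TLaw₁₃CoPH F N (⟨⟨theta13LiveOfRecord F N, Zr⟩, Zh, Phih⟩ : Stage13HParams F N) p k :=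
  tLaw₁₃CoPH_all_theta13LiveOfRecordH_of_obligations F N p hrec σ hσ
    (noExpansionObligation_of_gaussCert_of_operandRows hζ hq hrec (le_of_eq rfl) σ hσ.loc (operandRowsAlongChain_of_supplierTermRows hσr))

/-! ## §3. `B16.Thm1Printed` at the CoPH datum of the extension, per windowed run, the no-expansion obligation discharged from the rows -/

/-- **★★ `B16.Thm1Printed` AT THE CoPH DATUM OF ANY H-EXTENSION OF THE WITNESS OF RECORD FROM, PER WINDOWED RUN, A SUPPLIER WITH ITS OBLIGATIONS AND ITS TERM ROWS, `ZhUnity` AND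
THE WITNESS-FREE RESIDUAL ROWS — NOTHING ELSE** (p596032's per-run face; `T` = any `T`-family agreeing with the tower, the conclusion is `T`-free; the 𝐑-leaf is CLOSED there).
[cite: Balaban1988Convergent, Theorem p.245, Thm 1 p.262, p.244, (3.16)–(3.25) pp.268–270; Balaban1989LargeFieldII, Thm 1 p.355; Balaban1989LargeFieldI, (0.3) p.176, p.177 (i)–(ii)] -/
theorem thm1Printed_datumOfRecord₁₃CoPH_theta13LiveOfRecordH_of_obligations_of_residualRows_of_supplierTermRows
    (hrec : (⟨⟨theta13LiveOfRecord F N, Zr⟩, Zh, Phih⟩ : Stage13HParams F N).Provisos₁₃CoPH F N)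
    (hU : (⟨⟨theta13LiveOfRecord F N, Zr⟩, Zh, Phih⟩ : Stage13HParams F N).ZhUnity F N) {γ : ℝ} (hγ : 0 < γ)
    (T : (P : B12.RunParams) → (k : ℕ) → RTOpI (F.P P.K) k (SU N) (avOfRecord F N P.K k))
    (hTT : ∀ (P : B12.RunParams) (k : ℕ), k < P.K →
      (T P k).T (densOfRecord₁₃ F N (theta13LiveOfRecord F N) P k) = tdensOfRecord₁₃ F N (theta13LiveOfRecord F N) P k)
    (σ : (P : B12.RunParams) → Sect3Supplier (⟨⟨theta13LiveOfRecord F N, Zr⟩, Zh, Phih⟩ : Stage13HParams F N) P)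
    (hσ : ∀ P : B12.RunParams, ((datumOfRecord₁₃CoPH F N (⟨⟨theta13LiveOfRecord F N, Zr⟩, Zh, Phih⟩ : Stage13HParams F N) hrec).C P).flow.InInterval γ P.K →
      SupplierObligations (⟨⟨theta13LiveOfRecord F N, Zr⟩, Zh, Phih⟩ : Stage13HParams F N) P (σ P))
    (hres : ∀ P : B12.RunParams, ((datumOfRecord₁₃CoPH F N (⟨⟨theta13LiveOfRecord F N, Zr⟩, Zh, Phih⟩ : Stage13HParams F N) hrec).C P).flow.InInterval γ P.K →
      ResidualRows (⟨⟨theta13LiveOfRecord F N, Zr⟩, Zh, Phih⟩ : Stage13HParams F N) P)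
    (hσr : ∀ P : B12.RunParams, ((datumOfRecord₁₃CoPH F N (⟨⟨theta13LiveOfRecord F N, Zr⟩, Zh, Phih⟩ : Stage13HParams F N) hrec).C P).flow.InInterval γ P.K →
      SupplierTermRows (⟨⟨theta13LiveOfRecord F N, Zr⟩, Zh, Phih⟩ : Stage13HParams F N) P (σ P)) :
    B16.Thm1Printed (datumOfRecord₁₃CoPH F N (⟨⟨theta13LiveOfRecord F N, Zr⟩, Zh, Phih⟩ : Stage13HParams F N) hrec).C :=
  thm1Printed_datumOfRecord₁₃CoPH_theta13LiveOfRecordH_of_obligations F N hrec hγ T hTT σ hσ fun P hP =>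
    noExpansionObligation_of_residualRows_of_operandRows hrec hU (le_of_eq rfl) (σ P) (hσ P hP).loc (hres P hP)
      (operandRowsAlongChain_of_supplierTermRows (hσr P hP))

end Summit.QuantumFields.YangMills.Theorems.BalabanUVNodesN11Sect3SupplyChainTermRowsAtRecord

end
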